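import Summits.AtomisticToContinuum.Crystallization.Theses.PalmUnimodularRigidity
import Summits.AtomisticToContinuum.Crystallization.Theorems.MinimiserShells.Negative.LoadBearing
import Summits.AtomisticToContinuum.Crystallization.Theorems.MinimiserShells.Negative.Rootedness
import Summits.AtomisticToContinuum.Crystallization.Theorems.PalmUnimodularRigidityMinimiserShellsEquilibriumInLawWindow
import Summits.AtomisticToContinuum.Crystallization.Theorems.PalmUnimodularRigidityMinimiserShellsEquilibriumInLawRootSums
import Summits.AtomisticToContinuum.Crystallization.Theorems.PalmUnimodularRigidityMinimiserShellsEquilibriumInLawCellAverage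
import Literature.Probability.Process.PointStationaryLaw
import Literature.MathematicalPhysics.StatisticalMechanics.RootEnergy
import Literature.MathematicalPhysics.StatisticalMechanics.MuGSC

/-!
# The per-cell inequality: root energies of a cell versus its deep gain sites

Helper file for stub `stub_equilibriumInLaw` (S1) of line `equilibrium-in-law-surgery`, crux
`MinimiserShells` (stmt-AtomisticToContinuum-9225): the deterministic core of blueprint lemma 11.

`cell_real_inequality`: for every hard core `δ`, modification type `(n₀, k, r, ε, R')`, there are
`R₀, c > 0` such that for every grid size `L > 0`, every rooted `δ`-separated `S`, every phase `u`
and the finite window `C = S ∩ cell_u`: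
`#C · e* + c · #{y ∈ C : R₀ < depth(u − y), gainCount (θ_y count|S) ≠ 0}
   ≤ ∑_{y ∈ C} ( ½ ∑_{z ∈ S} V_LJ(|y − z|) + ½ tailBound δ ⌊depth(u − y)⌋ )`.
Proof: the root energies of the atoms of `C` add up to `½ ∑∑_C V + ½ ∑_{y ∈ C} (field from S ∖ C)`;
the first term is `≥ #C e* + c #G` by `window_inequality` (a deep gain site of the re-rooted
configuration is a deep gain site of `S`, `gain_translate`; depth `> R₀` puts `B̄(y, R₀)` inside the
cell, `closedBall_subset_cell`), and the field from outside the cell felt at integer depth `j` is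
`≥ −tailBound δ j` (`tsum_abs_lennardJones_le_of_far` beyond depth `j − 1 ≥ max 1 δ`, the crude
bound `Bδ` otherwise).
-/

noncomputable section

open MeasureTheory
open scoped ENNReal BigOperators

namespace Summit.AtomisticToContinuum.Crystallization.Theorems.PalmUnimodularRigidityMinimiserShells.EquilibriumInLaw.WindowReal

open Literature.Probability.Process (IsPointStationaryLaw IsRootedHardCore count_restrict_singleton_ne_zero_iff
  map_sub_count_restrict)
open Literature.MathematicalPhysics.StatisticalMechanics (lennardJones IsMuGSC UniformlyDiscrete)
open Summit.AtomisticToContinuum.Crystallization.Theses.PalmUnimodularRigidity (MinimiserShells UnimodularEnergyLowerBound)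
open Summit.AtomisticToContinuum.Crystallization.Theorems.MinimiserShells.Negative.LoadBearing
  (eStar meanRootEnergy GoodShell minimiserShells_iff)
open Literature.MathematicalPhysics.StatisticalMechanics (interactionEnergy fieldEnergy)
open Summit.AtomisticToContinuum.Crystallization.Theorems.MinimiserShells.Negative.Rootedness (E3
  countable_of_separated)
open Summit.AtomisticToContinuum.Crystallization.Theorems.PalmUnimodularRigidityMinimiserShells.EquilibriumInLaw.Shells
  (tsum_abs_lennardJones_le_of_far tsum_abs_lennardJones_le_crude)
open Summit.AtomisticToContinuum.Crystallization.Theorems.PalmUnimodularRigidityMinimiserShells.EquilibriumInLaw.Cluster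
  (tsum_sdiff_coe_eq_sum_add_tsum)
open Summit.AtomisticToContinuum.Crystallization.Theorems.PalmUnimodularRigidityMinimiserShells.EquilibriumInLaw.Window
  (window_inequality)
open Summit.AtomisticToContinuum.Crystallization.Theorems.PalmUnimodularRigidityMinimiserShells.EquilibriumInLaw.LfKernel
  (lfKernel_count_restrict)
open Summit.AtomisticToContinuum.Crystallization.Theorems.PalmUnimodularRigidityMinimiserShells.EquilibriumInLaw.GainEvent
  (gainCount exists_gain_of_gainCount_ne_zero)
open Summit.AtomisticToContinuum.Crystallization.Theorems.PalmUnimodularRigidityMinimiserShells.EquilibriumInLaw.Phase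
  (cell depth zero_mem_cell closedBall_subset_cell mem_cell_sub_iff depth_nonneg)
open Summit.AtomisticToContinuum.Crystallization.Theorems.PalmUnimodularRigidityMinimiserShells.EquilibriumInLaw.RootSums
  (Bδ tailBound gain_translate)
open Summit.AtomisticToContinuum.Crystallization.Theorems.PalmUnimodularRigidityMinimiserShells.EquilibriumInLaw.CellAverage
  (reroot reroot_eq_map)

/-- Deep atoms of the cell see a whole ball of `S` inside the cell: if `y ∈ cell_u` and
`ρ < depth L (u − y)` then `S ∩ B̄(y, ρ) ⊆ cell_u`. -/
theorem inter_closedBall_subset_cell {L : ℝ} (hL : 0 < L) {S : Set E3} {u y : E3} (hy : y ∈ cell L u)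
    {ρ : ℝ} (hρ : ρ < depth L (u - y)) : S ∩ Metric.closedBall y ρ ⊆ S ∩ cell L u := by
  rintro z ⟨hzS, hz⟩
  refine ⟨hzS, ?_⟩
  have h1 : z - y ∈ Metric.closedBall (0 : E3) ρ := by
    rw [Metric.mem_closedBall, dist_zero_right, ← dist_eq_norm]
    exact Metric.mem_closedBall.1 hz
  have h2 : z - y ∈ cell L (u - y) := closedBall_subset_cell hL hρ h1
  have h3 := (mem_cell_sub_iff L hy (z - y)).1 h2
  rwa [sub_add_cancel] at h3

/-- The field from outside the cell felt by an atom of the cell is `≥ −tailBound δ ⌊depth⌋`. -/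
theorem neg_tailBound_le_tsum {δ L : ℝ} (hδ : 0 < δ) (hL : 0 < L) {S : Set E3}
    (hsep : ∀ x ∈ S, ∀ z ∈ S, x ≠ z → δ ≤ dist x z) {u : E3} {C : Finset E3}
    (hC : (↑C : Set E3) = S ∩ cell L u) {y : E3} (hyC : y ∈ C) :
    -tailBound δ ⌊depth L (u - y)⌋₊ ≤ ∑' z : ↥(S \ ↑C), lennardJones (dist y z) := by
  have hyS : y ∈ S := (hC ▸ (Finset.mem_coe.2 hyC) : y ∈ S ∩ cell L u).1
  have hycell : y ∈ cell L u := (hC ▸ (Finset.mem_coe.2 hyC) : y ∈ S ∩ cell L u).2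
  have hT : ∀ z ∈ S \ (↑C : Set E3), ∀ w ∈ S \ (↑C : Set E3), z ≠ w → δ ≤ dist z w :=
    fun z hz w hw hzw => hsep z hz.1 w hw.1 hzw
  set j : ℕ := ⌊depth L (u - y)⌋₊ with hj
  have hjd : (j : ℝ) ≤ depth L (u - y) := Nat.floor_le (depth_nonneg hL.le _)
  unfold tailBound
  split_ifs with hcase
  · -- far case: every atom outside the cell is `≥ j - 1` away from `y`
    set ρ : ℝ := (j : ℝ) - 1 with hρ
    have hρ1 : max 1 δ ≤ ρ := by linarith
    have hρd : ρ < depth L (u - y) := by linarith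
    have hfar : ∀ z ∈ S \ (↑C : Set E3), ρ ≤ dist y z := by
      intro z hz
      by_contra hlt
      have hmem : z ∈ S ∩ Metric.closedBall y ρ := ⟨hz.1, Metric.mem_closedBall.2 (by
        rw [dist_comm]; exact (not_le.1 hlt).le)⟩
      have := inter_closedBall_subset_cell hL hycell hρd hmem
      exact hz.2 (hC ▸ this)
    have h := (tsum_abs_lennardJones_le_of_far (T := S \ ↑C) y hδ hρ1 hfar hT).2
    rw [abs_le] at h
    linarith [h.1]
  · have h := (tsum_abs_lennardJones_le_crude (T := S \ ↑C) y hδ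
      (fun z hz hzy => hsep y hyS z hz.1 (Ne.symm hzy)) hT).2
    rw [abs_le] at h
    unfold Bδ
    linarith [h.1]

/-- **The per-cell inequality.** See the module docstring. -/
theorem cell_real_inequality {δ : ℝ} (hδ : 0 < δ) (n₀ k : ℕ) {r ε : ℝ} (hr : 0 ≤ r) (hε : 0 < ε)
    (R' : Fin k → E3) :
    ∃ R₀ c : ℝ, 0 < R₀ ∧ 0 < c ∧ ∀ {L : ℝ}, 0 < L → ∀ {S : Set E3},
      (∀ x ∈ S, ∀ z ∈ S, x ≠ z → δ ≤ dist x z) → ∀ (u : E3) (C : Finset E3),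
      (↑C : Set E3) = S ∩ cell L u →
      (C.card : ℝ) * eStar + c * (C.filter fun y => R₀ < depth L (u - y) ∧
          gainCount n₀ k r ε R' (reroot ((Measure.count : Measure E3).restrict S, y)) ≠ 0).card ≤
        ∑ y ∈ C, ((∑' z : S, lennardJones (dist y z)) / 2 + tailBound δ ⌊depth L (u - y)⌋₊ / 2) := by
  obtain ⟨R₀, c, hR₀, hc, hwin⟩ := window_inequality hδ n₀ k hr hε
  refine ⟨R₀, c, hR₀, hc, ?_⟩
  intro L hL S hsep u C hC
  have hCS : (↑C : Set E3) ⊆ S := hC ▸ Set.inter_subset_left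
  have hud : UniformlyDiscrete (S \ ↑C) := ⟨δ, hδ, fun x hx z hz hxz => hsep x hx.1 z hz.1 hxz⟩
  have hκ := lfKernel_count_restrict hδ hsep
  -- the gain predicate and its witnesses
  set Gain : E3 → Prop := fun y =>
    gainCount n₀ k r ε R' (reroot ((Measure.count : Measure E3).restrict S, y)) ≠ 0 with hGain
  have hGainw : ∀ y, Gain y → ∃ (xf : Fin n₀ → E3) (R : Fin k → E3),
      Function.Injective xf ∧ Set.range xf ⊆ S ∧ (∀ l, dist (xf l) y ≤ r) ∧
      Function.Injective R ∧ (∀ i, dist (R i) y ≤ r) ∧ Disjoint (Set.range R) (S \ Set.range xf) ∧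
      interactionEnergy lennardJones R + fieldEnergy lennardJones R (S \ Set.range xf) - eStar * k + ε ≤
        interactionEnergy lennardJones xf + fieldEnergy lennardJones xf (S \ Set.range xf) -
          eStar * n₀ := by
    intro y hy
    have hsep' : ∀ x ∈ (fun z => z - y) '' S, ∀ x' ∈ (fun z => z - y) '' S, x ≠ x' → δ ≤ dist x x' := by
      rintro _ ⟨a, ha, rfl⟩ _ ⟨b, hb, rfl⟩ hne
      rw [dist_sub_right]
      exact hsep a ha b hb fun h => hne (by rw [h])
    have hrr : reroot ((Measure.count : Measure E3).restrict S, y) =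
        (Measure.count : Measure E3).restrict ((fun z => z - y) '' S) := by
      rw [reroot_eq_map hκ y, map_sub_count_restrict]
    simp only [hGain, hrr] at hy
    obtain ⟨xf', hinj, hxS, hxr, hRinj, hRr, hdisj, hineq⟩ := exists_gain_of_gainCount_ne_zero hδ hsep' hy
    exact gain_translate y hinj hxS hxr hRinj hRr hdisj hineq
  -- the deep gain sites
  set G := C.filter (fun y => R₀ < depth L (u - y) ∧ Gain y) with hG
  have hGC : G ⊆ C := Finset.filter_subset _ _
  have hGdeep : ∀ y ∈ G, Gain y ∧ S ∩ Metric.closedBall y R₀ ⊆ ↑C := by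
    intro y hy
    obtain ⟨hyC, hdep, hg⟩ := Finset.mem_filter.1 hy
    refine ⟨hg, ?_⟩
    have hycell : y ∈ cell L u := (hC ▸ (Finset.mem_coe.2 hyC) : y ∈ S ∩ cell L u).2
    rw [hC]
    exact inter_closedBall_subset_cell hL hycell hdep
  have key := hwin S hsep Gain hGainw C hCS G hGC hGdeep
  -- the root energies of the atoms of `C`
  have hsplit : ∀ y ∈ C, ∑' z : S, lennardJones (dist y z) =
      ∑ z ∈ C, lennardJones (dist y z) + ∑' z : ↥(S \ ↑C), lennardJones (dist y z) := by
    intro y _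
    have h := tsum_sdiff_coe_eq_sum_add_tsum hCS (Finset.empty_subset C) (fun z => lennardJones (dist y z))
      (hud.summable_lennardJones y)
    rw [Finset.sdiff_empty] at h
    rw [← h]
    exact tsum_congr_set_coe (fun z => lennardJones (dist y z)) (by rw [Finset.coe_empty, Set.sdiff_empty])
  have htail : ∀ y ∈ C, -tailBound δ ⌊depth L (u - y)⌋₊ ≤ ∑' z : ↥(S \ ↑C), lennardJones (dist y z) :=
    fun y hy => neg_tailBound_le_tsum hδ hL hsep hC hy
  calc (C.card : ℝ) * eStar + c * G.card ≤ (∑ x ∈ C, ∑ z ∈ C, lennardJones (dist x z)) / 2 := key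
    _ ≤ ∑ y ∈ C, ((∑' z : S, lennardJones (dist y z)) / 2 + tailBound δ ⌊depth L (u - y)⌋₊ / 2) := by
        rw [Finset.sum_div]
        refine Finset.sum_le_sum fun y hy => ?_
        rw [hsplit y hy]
        linarith [htail y hy]

/-- Registered stub marker (helper part 12/14 of `stub_equilibriumInLaw`, line `equilibrium-in-law-surgery`):
the per-cell real inequality `cell_real_inequality`, closed form. -/
theorem stub_equilibriumInLaw_part12 :
    ∀ (δ : ℝ), 0 < δ → ∀ (n₀ k : ℕ) (r ε : ℝ), 0 ≤ r → 0 < ε → ∀ (R' : Fin k → EuclideanSpace ℝ (Fin 3)),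
    ∃ R₀ c : ℝ, 0 < R₀ ∧ 0 < c ∧ ∀ {L : ℝ}, 0 < L → ∀ {S : Set (EuclideanSpace ℝ (Fin 3))},
      (∀ x ∈ S, ∀ z ∈ S, x ≠ z → δ ≤ dist x z) → ∀ (u : EuclideanSpace ℝ (Fin 3)) (C : Finset (EuclideanSpace ℝ (Fin 3))),
      (↑C : Set (EuclideanSpace ℝ (Fin 3))) = S ∩ cell L u →
      (C.card : ℝ) * eStar + c * (C.filter fun y => R₀ < depth L (u - y) ∧
          gainCount n₀ k r ε R' (reroot ((Measure.count : Measure (EuclideanSpace ℝ (Fin 3))).restrict S, y)) ≠ 0).card ≤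
        ∑ y ∈ C, ((∑' z : S, lennardJones (dist y z)) / 2 + tailBound δ ⌊depth L (u - y)⌋₊ / 2) :=
  fun _ hδ n₀ k _ _ hr hε R' => cell_real_inequality hδ n₀ k hr hε R'

end Summit.AtomisticToContinuum.Crystallization.Theorems.PalmUnimodularRigidityMinimiserShells.EquilibriumInLaw.WindowReal

end
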